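import Mathlib.Geometry.Manifold.Instances.Real
import Literature.Geometry.Lorentzian.PseudoRiemannianMetric
import Literature.Geometry.Lorentzian.KerrSchild
import Literature.Geometry.Riemannian.RiemannianMetricExists
import HarnessLib

/-!
# The carrier `PseudoRiemannianMetric IB n F E` is inhabited (carrier witness, libB)

Topic `Geometry/Lorentzian`. The structure
`Literature.Geometry.Lorentzian.PseudoRiemannianMetric IB n F E` (`PseudoRiemannianMetric.lean`:
a `C^n` family of symmetric nondegenerate continuous bilinear forms on the fibres of a real
vector bundle `E → B`, O'Neill 1983, Ch. 3, Def. 3.1) is the carrier over which the Riemannian /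
Lorentzian items of the tree quantify, almost always in the tangent-bundle shape
`PseudoRiemannianMetric (𝓡 d) ∞ (EuclideanSpace ℝ (Fin d)) (TangentSpace (𝓡 d) : M → Type _)`
under the binders `[T2Space M] [SecondCountableTopology M] [ChartedSpace (EuclideanSpace ℝ (Fin d)) M]
[IsManifold (𝓡 d) ∞ M]` (or `[CompactSpace M]`, or the half-space model `𝓡∂ d`, or a general
model with corners `I` over a finite-dimensional `E`). This file records, with proofs and no new
notion or named fact, that the carrier is inhabited over that whole region, and exhibits the
standard explicit inhabitants.

## Results

* `PseudoRiemannianMetric_nonempty` — **tangent bundles**: for every model with corners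
  `I : ModelWithCorners ℝ E H` with `E` finite-dimensional, every `C^∞` manifold `M` on `I` which
  is Hausdorff and σ-compact, and every regularity `n ≤ ∞`,
  `Nonempty (PseudoRiemannianMetric I n E (TangentSpace I : M → Type _))`. Proof: the tree's
  PROVED existence theorem for Riemannian metrics `Literature.Geometry.Riemannian.exists_isRiemannian`
  (`RiemannianMetricExists.lean`; Lee 2012, Prop. 13.3, partition of unity — the argument printed
  in Hawking–Ellis 1973, §2.6: "Any paracompact `C^r` manifold admits a `C^{r-1}` positive
  definite metric … `g(X, Y) = Σ_α f_α ⟨(φ_α)_* X, (φ_α)_* Y⟩`", and Aubin 1982, Thm. 1.16), followed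
  by `PseudoRiemannianMetric.ofLE`; the Riemannian witness is kept in
  `PseudoRiemannianMetric.exists_isRiemannian_of_le`. Registered as a `Nonempty` instance for every
  `n` with `[ENat.LEInfty n]`.
* `PseudoRiemannianMetric_nonempty_of_secondCountable` — the same under the literal item binder
  `[SecondCountableTopology M]` (σ-compactness from `Manifold.locallyCompact_of_finiteDimensional`
  and `sigmaCompactSpace_of_locallyCompact_secondCountable`); also an instance; specialised to
  the shapes that occur in the summit files as `PseudoRiemannianMetric_nonempty_euclidean`
  (`𝓡 d`, closed manifolds) and `PseudoRiemannianMetric_nonempty_euclideanHalfSpace` (`𝓡∂ d`,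
  manifolds with boundary).
* `PseudoRiemannianMetric_nonempty_of_isContMDiffRiemannianBundle` — **general vector bundles**:
  a Riemannian bundle in Mathlib's sense (`IsContMDiffRiemannianBundle IB n F E`, inner-product
  fibres depending `C^n` on the base) carries a `C^n` pseudo-Riemannian metric, its inner product
  (O'Neill 1983, Ch. 3, p. 55: a positive definite scalar product is nondegenerate); instance; in
  particular every trivial bundle with inner-product model fibre
  (`PseudoRiemannianMetric_nonempty_trivial`), at every regularity including `ω`.
* `PseudoRiemannianMetric_nonempty_of_contMDiffRiemannianMetric` — any Mathlib
  `Bundle.ContMDiffRiemannianMetric IB n F E` gives an inhabitant (`ofRiemannian`).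
* Explicit model inhabitants at every regularity `n` (including `ω`): the **Euclidean metric**
  of a real inner product space `F` on `T F` (`PseudoRiemannianMetric_nonempty_vectorSpace`,
  Mathlib's `riemannianMetricVectorSpace F` through `ofRiemannian`; O'Neill 1983, Ch. 3, p. 55,
  `ℝⁿ_ν` with `ν = 0`), an instance — for `F = EuclideanSpace ℝ (Fin d)` this is the carrier of the
  items at `M = ℝ^d` since `𝓡 d = 𝓘(ℝ, EuclideanSpace ℝ (Fin d))` by `rfl`
  (`PseudoRiemannianMetric_nonempty_euclideanSpace_self`); and **Minkowski space** `ℝ⁴₁`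
  (`PseudoRiemannianMetric_nonempty_minkowski`, the tree's `Minkowski.metric` of `KerrSchild.lean`;
  O'Neill 1983, Ch. 3, p. 55 and Ch. 5, Ex. 5.1), a Lorentzian inhabitant.

## Scope

The unrestricted statement `∀ IB n F E, Nonempty (PseudoRiemannianMetric IB n F E)` is not a
theorem and is not claimed: the existence argument needs partitions of unity on the base
(Hawking–Ellis 1973, §2.6 and Lee 2012, Prop. 13.3 assume paracompactness; here
`[T2Space M] [SigmaCompactSpace M]`, the hypotheses of `exists_isRiemannian`), and regularity `ω`
would ask for real-analytic metrics, which the partition-of-unity proof does not produce. Every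
carrier instance in the summit files lies in the region covered here (tangent bundle of a
Hausdorff, second-countable or compact, `C^∞` manifold over a finite-dimensional real model,
regularity `∞`). No `IsEmpty` region is asserted.

## References

* B. O'Neill, *Semi-Riemannian geometry with applications to relativity*, Academic Press 1983,
  Ch. 3, Def. 3.1 and p. 55 (`ℝⁿ_ν`, Minkowski space `ℝ⁴₁`); Ch. 5, Ex. 5.1. [ONeill1983]
* S. W. Hawking, G. F. R. Ellis, *The large scale structure of space-time*, CUP 1973, §2.6
  (existence of positive definite metrics on paracompact manifolds). [HawkingEllis1973]
* J. M. Lee, *Introduction to Smooth Manifolds*, 2nd ed., GTM 218 (2012), Prop. 13.3. [Lee2012]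
* T. Aubin, *Nonlinear Analysis on Manifolds. Monge–Ampère Equations*, Springer 1982,
  Thm. 1.16. [Aubin1982]
-/

noncomputable section

open Manifold Bundle
open scoped ContDiff Topology

namespace Literature.Geometry.Lorentzian

/-! ### Tangent bundles of σ-compact Hausdorff `C^∞` manifolds (the item region) -/

section TangentBundle

variable {E : Type*} [NormedAddCommGroup E] [NormedSpace ℝ E] {H : Type*} [TopologicalSpace H]
  {I : ModelWithCorners ℝ E H} {n : ℕ∞ω} {M : Type*} [TopologicalSpace M] [ChartedSpace H M]

/-- **Existence of Riemannian metrics at every regularity `n ≤ ∞`.** On a `C^∞` manifold `M` over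
a finite-dimensional real model, Hausdorff and σ-compact, there is a `C^n` pseudo-Riemannian
metric on `TM` which is Riemannian (positive definite): the `C^∞` metric of
`Literature.Geometry.Riemannian.exists_isRiemannian` (Lee 2012, Prop. 13.3; Hawking–Ellis 1973,
§2.6; Aubin 1982, Thm. 1.16), with its regularity lowered by `ofLE` (same bilinear forms).
[cite: Lee2012, Prop. 13.3] [cite: HawkingEllis1973, §2.6] -/
theorem PseudoRiemannianMetric.exists_isRiemannian_of_le [FiniteDimensional ℝ E]
    [IsManifold I ∞ M] [T2Space M] [SigmaCompactSpace M] (hn : n ≤ ∞) :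
    ∃ g : PseudoRiemannianMetric I n E (TangentSpace I : M → Type _), g.IsRiemannian := by
  obtain ⟨g, hg⟩ := Literature.Geometry.Riemannian.exists_isRiemannian (I := I) (M := M)
  exact ⟨g.ofLE hn, fun b v hv ↦ hg b v hv⟩

/-- **The carrier is inhabited over tangent bundles** (libB carrier witness for
`Literature.Geometry.Lorentzian.PseudoRiemannianMetric`): for every model with corners `I` over a
finite-dimensional real normed space `E`, every `C^∞` manifold `M` on `I` that is Hausdorff and
σ-compact (e.g. compact, or second countable — see
`PseudoRiemannianMetric_nonempty_of_secondCountable`), and every regularity `n ≤ ∞`, the type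
`PseudoRiemannianMetric I n E (TangentSpace I : M → Type _)` is nonempty; an inhabitant is a
Riemannian metric obtained by the partition-of-unity construction (Lee 2012, Prop. 13.3;
Hawking–Ellis 1973, §2.6: "Any paracompact `C^r` manifold admits a `C^{r-1}` positive
definite metric"). [cite: Lee2012, Prop. 13.3] [cite: HawkingEllis1973, §2.6] -/
theorem PseudoRiemannianMetric_nonempty [FiniteDimensional ℝ E] [IsManifold I ∞ M] [T2Space M]
    [SigmaCompactSpace M] (hn : n ≤ ∞) :
    Nonempty (PseudoRiemannianMetric I n E (TangentSpace I : M → Type _)) :=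
  let ⟨g, _⟩ := PseudoRiemannianMetric.exists_isRiemannian_of_le (I := I) (M := M) hn
  ⟨g⟩

/-- Instance form of `PseudoRiemannianMetric_nonempty`, for the regularities `n` with
`[ENat.LEInfty n]` (all finite `n` and `∞`). [cite: Lee2012, Prop. 13.3] -/
instance instNonemptyPseudoRiemannianMetricTangentSpace [FiniteDimensional ℝ E]
    [IsManifold I ∞ M] [T2Space M] [SigmaCompactSpace M] [h : ENat.LEInfty n] :
    Nonempty (PseudoRiemannianMetric I n E (TangentSpace I : M → Type _)) :=
  PseudoRiemannianMetric_nonempty h.out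

/-- **The carrier is inhabited under the literal item binders** `[T2Space M]
[SecondCountableTopology M] [IsManifold I ∞ M]`: a second-countable manifold over a
finite-dimensional real model is locally compact (`Manifold.locallyCompact_of_finiteDimensional`)
hence σ-compact (`sigmaCompactSpace_of_locallyCompact_secondCountable`), and
`PseudoRiemannianMetric_nonempty` applies. [cite: Lee2012, Prop. 13.3] -/
theorem PseudoRiemannianMetric_nonempty_of_secondCountable [FiniteDimensional ℝ E]
    [IsManifold I ∞ M] [T2Space M] [SecondCountableTopology M] (hn : n ≤ ∞) :
    Nonempty (PseudoRiemannianMetric I n E (TangentSpace I : M → Type _)) := by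
  haveI := Manifold.locallyCompact_of_finiteDimensional (M := M) I
  exact PseudoRiemannianMetric_nonempty hn

/-- Instance form of `PseudoRiemannianMetric_nonempty_of_secondCountable`. [cite: Lee2012, Prop. 13.3] -/
instance instNonemptyPseudoRiemannianMetricTangentSpaceOfSecondCountable [FiniteDimensional ℝ E]
    [IsManifold I ∞ M] [T2Space M] [SecondCountableTopology M] [h : ENat.LEInfty n] :
    Nonempty (PseudoRiemannianMetric I n E (TangentSpace I : M → Type _)) :=
  PseudoRiemannianMetric_nonempty_of_secondCountable h.out

/-- The item shape of the four-dimensional summits, in every dimension `d`: a Hausdorff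
second-countable `C^∞` manifold `M` modelled on `𝓡 d` carries a `C^∞` pseudo-Riemannian metric
on `TM`, i.e. `PseudoRiemannianMetric (𝓡 d) ∞ (EuclideanSpace ℝ (Fin d)) (TangentSpace (𝓡 d) :
M → Type _)` is nonempty. [cite: Lee2012, Prop. 13.3] -/
theorem PseudoRiemannianMetric_nonempty_euclidean (d : ℕ) (M : Type*) [TopologicalSpace M]
    [T2Space M] [SecondCountableTopology M] [ChartedSpace (EuclideanSpace ℝ (Fin d)) M]
    [IsManifold (𝓡 d) ∞ M] :
    Nonempty (PseudoRiemannianMetric (𝓡 d) ∞ (EuclideanSpace ℝ (Fin d))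
      (TangentSpace (𝓡 d) : M → Type _)) :=
  PseudoRiemannianMetric_nonempty_of_secondCountable le_rfl

/-- The item shape for manifolds with boundary: a Hausdorff second-countable `C^∞` manifold `M`
modelled on the half-space model `𝓡∂ d` carries a `C^∞` pseudo-Riemannian metric on `TM`
(Lee 2012, Prop. 13.3: "Every smooth manifold with or without boundary admits a Riemannian
metric"). [cite: Lee2012, Prop. 13.3] -/
theorem PseudoRiemannianMetric_nonempty_euclideanHalfSpace (d : ℕ) [NeZero d] (M : Type*)
    [TopologicalSpace M] [T2Space M] [SecondCountableTopology M]
    [ChartedSpace (EuclideanHalfSpace d) M] [IsManifold (𝓡∂ d) ∞ M] :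
    Nonempty (PseudoRiemannianMetric (𝓡∂ d) ∞ (EuclideanSpace ℝ (Fin d))
      (TangentSpace (𝓡∂ d) : M → Type _)) :=
  PseudoRiemannianMetric_nonempty_of_secondCountable le_rfl

/-- The compact case (closed manifolds, `[CompactSpace M] [T2Space M]`, no countability
hypothesis): compact spaces are σ-compact. [cite: Lee2012, Prop. 13.3] -/
theorem PseudoRiemannianMetric_nonempty_of_compactSpace [FiniteDimensional ℝ E]
    [IsManifold I ∞ M] [T2Space M] [CompactSpace M] (hn : n ≤ ∞) :
    Nonempty (PseudoRiemannianMetric I n E (TangentSpace I : M → Type _)) :=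
  PseudoRiemannianMetric_nonempty hn

end TangentBundle

/-! ### General vector bundles: Riemannian bundles and Riemannian metrics -/

section RiemannianBundle

variable {EB : Type*} [NormedAddCommGroup EB] [NormedSpace ℝ EB] {HB : Type*} [TopologicalSpace HB]
  {IB : ModelWithCorners ℝ EB HB} {n : ℕ∞ω} {B : Type*} [TopologicalSpace B] [ChartedSpace HB B]
  {F : Type*} [NormedAddCommGroup F] [NormedSpace ℝ F]
  {E : B → Type*} [TopologicalSpace (TotalSpace F E)] [∀ x, NormedAddCommGroup (E x)]
  [∀ x, InnerProductSpace ℝ (E x)] [FiberBundle F E] [VectorBundle ℝ F E]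

/-- **A Riemannian bundle carries a pseudo-Riemannian metric.** If the fibres of `E → B` are
inner product spaces depending `C^n` on the base point (Mathlib's
`IsContMDiffRiemannianBundle IB n F E`), the inner product is a `C^n` pseudo-Riemannian metric on
`E`: it is symmetric, and positive definite hence nondegenerate (O'Neill 1983, Ch. 3, p. 55: an
inner product is a scalar product of index `0`). [cite: ONeill1983, Ch. 3 p. 55] -/
theorem PseudoRiemannianMetric_nonempty_of_isContMDiffRiemannianBundle
    [h : IsContMDiffRiemannianBundle IB n F E] : Nonempty (PseudoRiemannianMetric IB n F E) := by
  obtain ⟨g, hg, hinner⟩ := h.exists_contMDiff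
  refine ⟨⟨g, fun b v w ↦ ?_, fun b v hv ↦ ?_, hg⟩⟩
  · rw [← hinner, ← hinner, real_inner_comm]
  · have h0 : inner ℝ v v = 0 := (hinner b v v).trans (hv v)
    exact inner_self_eq_zero.mp h0

/-- Instance form of `PseudoRiemannianMetric_nonempty_of_isContMDiffRiemannianBundle`.
[cite: ONeill1983, Ch. 3 p. 55] -/
instance instNonemptyPseudoRiemannianMetricOfIsContMDiffRiemannianBundle
    [IsContMDiffRiemannianBundle IB n F E] : Nonempty (PseudoRiemannianMetric IB n F E) :=
  PseudoRiemannianMetric_nonempty_of_isContMDiffRiemannianBundle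

omit [TopologicalSpace (TotalSpace F E)] [∀ x, NormedAddCommGroup (E x)]
  [∀ x, InnerProductSpace ℝ (E x)] [FiberBundle F E] [VectorBundle ℝ F E] in
/-- **The trivial bundle** `B × F₁ → B` with an inner-product model fibre `F₁` carries a `C^n`
pseudo-Riemannian metric for every `n` (including `ω`): the constant inner product (Mathlib's
`IsContMDiffRiemannianBundle` instance for `Bundle.Trivial`). [cite: ONeill1983, Ch. 3 p. 55] -/
theorem PseudoRiemannianMetric_nonempty_trivial {F₁ : Type*} [NormedAddCommGroup F₁]
    [InnerProductSpace ℝ F₁] : Nonempty (PseudoRiemannianMetric IB n F₁ (Bundle.Trivial B F₁)) :=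
  inferInstance

end RiemannianBundle

section OfRiemannian

variable {EB : Type*} [NormedAddCommGroup EB] [NormedSpace ℝ EB] {HB : Type*} [TopologicalSpace HB]
  {IB : ModelWithCorners ℝ EB HB} {n : ℕ∞ω} {B : Type*} [TopologicalSpace B] [ChartedSpace HB B]
  {F : Type*} [NormedAddCommGroup F] [NormedSpace ℝ F]
  {E : B → Type*} [TopologicalSpace (TotalSpace F E)]
  [∀ b, TopologicalSpace (E b)] [∀ b, AddCommGroup (E b)] [∀ b, Module ℝ (E b)]
  [FiberBundle F E] [VectorBundle ℝ F E]

/-- A Mathlib `C^n` Riemannian metric `Bundle.ContMDiffRiemannianMetric IB n F E` on a vector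
bundle gives an inhabitant of the carrier (`PseudoRiemannianMetric.ofRiemannian`: positivity
implies nondegeneracy, O'Neill 1983, Ch. 3, p. 55). [cite: ONeill1983, Ch. 3 p. 55] -/
theorem PseudoRiemannianMetric_nonempty_of_contMDiffRiemannianMetric
    (h : Nonempty (ContMDiffRiemannianMetric IB n F E)) :
    Nonempty (PseudoRiemannianMetric IB n F E) :=
  h.map PseudoRiemannianMetric.ofRiemannian

end OfRiemannian

/-! ### Explicit inhabitants on model spaces: Euclidean and Minkowski space -/

section ModelSpace

variable {n : ℕ∞ω}

/-- **The Euclidean metric of a real inner product space** `F`, on the tangent bundle of `F`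
regarded as a manifold modelled on itself, inhabits the carrier at every regularity `n`
(including `ω`): Mathlib's analytic `riemannianMetricVectorSpace F` through `ofRiemannian` and
`ofLE` (this is `Literature.Geometry.Riemannian.euclideanMetric F` of `RoundSphere.lean` at
`n = ∞`). O'Neill 1983, Ch. 3, p. 55 (`ℝⁿ_ν` with `ν = 0`). [cite: ONeill1983, Ch. 3 p. 55] -/
theorem PseudoRiemannianMetric_nonempty_vectorSpace (F : Type*) [NormedAddCommGroup F]
    [InnerProductSpace ℝ F] :
    Nonempty (PseudoRiemannianMetric 𝓘(ℝ, F) n F (TangentSpace 𝓘(ℝ, F) : F → Type _)) :=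
  ⟨(PseudoRiemannianMetric.ofRiemannian (riemannianMetricVectorSpace F)).ofLE le_top⟩

/-- Instance form of `PseudoRiemannianMetric_nonempty_vectorSpace` (every regularity).
[cite: ONeill1983, Ch. 3 p. 55] -/
instance instNonemptyPseudoRiemannianMetricVectorSpace (F : Type*) [NormedAddCommGroup F]
    [InnerProductSpace ℝ F] :
    Nonempty (PseudoRiemannianMetric 𝓘(ℝ, F) n F (TangentSpace 𝓘(ℝ, F) : F → Type _)) :=
  PseudoRiemannianMetric_nonempty_vectorSpace F

/-- The carrier of the items at the model space itself, `M = EuclideanSpace ℝ (Fin d)` with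
`𝓡 d = 𝓘(ℝ, EuclideanSpace ℝ (Fin d))` (`rfl`), at every regularity: the Euclidean metric of
`ℝ^d`. O'Neill 1983, Ch. 3, p. 55. [cite: ONeill1983, Ch. 3 p. 55] -/
theorem PseudoRiemannianMetric_nonempty_euclideanSpace_self (d : ℕ) :
    Nonempty (PseudoRiemannianMetric (𝓡 d) n (EuclideanSpace ℝ (Fin d))
      (TangentSpace (𝓡 d) : EuclideanSpace ℝ (Fin d) → Type _)) :=
  PseudoRiemannianMetric_nonempty_vectorSpace (EuclideanSpace ℝ (Fin d))

/-- **Minkowski space** `ℝ⁴₁ = (E4, η)`, `η = −dt² + dx² + dy² + dz²`, inhabits the carrier on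
`T E4` at every regularity (a Lorentzian inhabitant: the tree's analytic `Minkowski.metric` of
`KerrSchild.lean`, regularity lowered by `ofLE`). O'Neill 1983, Ch. 3, p. 55 and Ch. 5, Ex. 5.1;
Hawking–Ellis 1973, §5.1. [cite: ONeill1983, Ch. 3 p. 55 and Ch. 5 Ex. 5.1] -/
theorem PseudoRiemannianMetric_nonempty_minkowski :
    Nonempty (PseudoRiemannianMetric 𝓘(ℝ, E4) n E4 (TangentSpace 𝓘(ℝ, E4) : E4 → Type _)) :=
  ⟨Minkowski.metric.toPseudoRiemannianMetric.ofLE le_top⟩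

/-- The Minkowski inhabitant is `η` at every point. [cite: ONeill1983, Ch. 3 p. 55] -/
theorem val_minkowski_ofLE (x : E4) :
    (Minkowski.metric.toPseudoRiemannianMetric.ofLE (n' := n) le_top).val x = Minkowski.bilin :=
  rfl

end ModelSpace

end Literature.Geometry.Lorentzian

end
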